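import Literature.NumberTheory.EllipticCurves.LocalTatePairingPoints
import Literature.NumberTheory.EllipticCurves.LocalTateSelfDualityTorsionAnyInv
import Literature.NumberTheory.GaloisCohomology.PoitouTateSelmerStructuresCharacterLift
import Mathlib.CategoryTheory.CofilteredSystem
import Mathlib.CategoryTheory.Functor.OfSequence
import HarnessLib

/-!
# Local Tate duality with the Kummer image at level `p^k`: every additive `φ : E(F) → ℤ_p` is `⟨x_k, κ_{p^k}(·)⟩ mod p^k`

Topic `NumberTheory/EllipticCurves`; namespace `Literature.NumberTheory.EllipticCurves`. Sequel of `LocalTatePairingPoints.lean`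
(brick K2 floor (c′) of the hT₂ programme of crux K★ stmt-BirchSwinnertonDyer-22226, memo `Summits/BirchSwinnertonDyer/
BirchSwinnertonDyer/Cruxes/StarredOptimalManinUnitFiveSeven/Lines/kato-lever-hT2-programme.md` §4): floor (d), LEVELWISE half of
[TD] («every additive `φ : E(F) → ℤ_p` is `⟨x, κ(·)⟩` for some `x ∈ H¹(F, T_pW)`»). Definitions with bodies and theorems; no named
fact, no instance, no `sorry`.

* `exists_kummerLevelClass_eq_of_mem` — every class in the local Kummer condition `𝓛 = kummerLocalConditionAt` is `κ_{p^k}(P)` for an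
  `F`-rational `P` (the tree's `range_localKummerMap`: exactness of the local Kummer sequence + Galois descent);
* `toZModPow_apply_eq_of_kummerLevelClass_eq` — `κ_{p^k}(P) = κ_{p^k}(P′) ⇒ φ(P) ≡ φ(P′) (mod p^k)` (the tree's `ker_localKummerMap`:
  then `P − P′ ∈ p^k E(F)`);
* `kummerFunctional φ k : 𝓛 →+ ℤ/p^k` — the functional `κ_{p^k}(P) ↦ φ(P) mod p^k` on the Kummer image (well defined by the above);
* ★ `exists_levelTatePairing_kummerLevelClass_eq` — **for every additive `φ : E(F) → ℤ_p` and every `k` there is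
  `x_k ∈ H¹(F, E[p^k]|_{Γ_F})` with `⟨x_k, κ_{p^k}(P)⟩_{p^k, inv_{p^k}} = φ(P) mod p^k` for all `P ∈ E(F)`**: extend `kummerFunctional`
  to `H¹(F, E[p^k]|)` (the tree's `AddMonoidHom.exists_comp_subtype_eq_of_nsmul_eq_zero`, Milne I §0 (0.19)) and represent it by
  local Tate duality for THE invariant map (`levelTatePairing_bijective_of_bijective` + `invLevel_bijective`);
* `exists_seq_apply_succ_eq` — the sequential Kőnig lemma (Mathlib's `nonempty_sections_of_finite_inverse_system` on
  `Functor.ofOpSequence`), and ★★ `exists_coherent_levelTatePairing_kummerLevelClass_eq` — the `x_k` can be chosen COMPATIBLY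
  along `p : E[p^{k+1}] → E[p^k]` (the solution sets are non-empty finite and `p_*` maps level `k+1` solutions to level `k` ones by
  the level change of floor (b) and the compatibility of the Kummer classes).

What is left of [TD] after this file: the lift of the coherent family `(x_k)_k ∈ lim_k H¹(F, E[p^k]|)` to ONE class of `H¹(F, T_pW)`
(`H¹(lim) ↠ lim H¹` for towers of finite modules with surjective transitions, the tree's `DiscreteModuleInverseLimitH1`, once
`T_pW|_{Γ_F}` is presented as that inverse limit). BSD is not proved by any of this.

## References
* J. S. Milne, *Arithmetic Duality Theorems*, 2nd ed. 2006, I §0 Prop. 0.19 (d), I Cor. 2.3, I §3 Cor. 3.4. [MilneADT2006]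
* J. H. Silverman, *The Arithmetic of Elliptic Curves*, 2nd ed. 2009, VIII §1 (Prop. 1.2, Galois descent), VIII §2, X §4. [SilvermanAEC2009]
* S. Bloch, K. Kato (1990), §3 Prop. 3.8. [BlochKato1990]
-/

noncomputable section

open scoped Classical

open CategoryTheory Function Field
open Literature.NumberTheory.GaloisRepresentations
open Literature.NumberTheory.GaloisRepresentations.DiscreteGaloisModule (mu MuCarrier)
open Literature.NumberTheory.PAdicHodge (restrictedTateRep restrictedTateRep_apply_apply)
open Literature.AnabelianGeometry.AbsoluteAnabelian (Prop121vii.invLevel invLevel_bijective)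

namespace Literature.NumberTheory.EllipticCurves

open _root_.WeierstrassCurve

attribute [local instance] absoluteGaloisGroup_compactSpace
attribute [local instance] finite_geomTorsion_of_neZero

variable {K₀ : Type} [Field K₀] [CharZero K₀] (W : WeierstrassCurve K₀) [W.IsElliptic] (F : Type) [Field F]
  [Algebra K₀ F] (p : ℕ) [hp : Fact p.Prime]

/-- `p^k ≠ 0`: instance bookkeeping for the levels. [folklore] -/
private theorem neZero_pow'' (k : ℕ) : NeZero (p ^ k) := ⟨pow_ne_zero k hp.out.ne_zero⟩

attribute [local instance] neZero_pow''

omit [CharZero K₀] [W.IsElliptic] in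
/-- `p^k ≠ 0` in `ℤ`. [folklore] -/
private theorem pow_ne_zero_int' (k : ℕ) : ((p ^ k : ℕ) : ℤ) ≠ 0 := by
  exact_mod_cast pow_ne_zero k hp.out.ne_zero

/-! ### The level-`p^k` Kummer image and functionals on it -/

variable [CharZero F]

/-- **Every class in the local Kummer condition is `κ_{p^k}(P)` for an `F`-rational `P`** (exactness of the local Kummer
sequence, `exists_eq_localKummerClass_of_mem`, and Galois descent). [cite: SilvermanAEC2009, X.§4 diagram (**)] -/
theorem exists_kummerLevelClass_eq_of_mem (k : ℕ) {c : continuousCohomology 1 (torsionRestricted W F (p ^ k)).toTopRep}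
    (hc : c ∈ W.kummerLocalConditionAt ((p ^ k : ℕ) : ℤ) F) : ∃ P : (W.baseChange F).toAffine.Point, kummerLevelClass W F p k P = c := by
  have hc' : c ∈ (W.localKummerMap F (pow_ne_zero_int' p k)).range := by rwa [W.range_localKummerMap F (pow_ne_zero_int' p k)]
  obtain ⟨P, hP⟩ := hc'
  exact ⟨P, hP⟩

omit [CharZero F] in
/-- `κ_{p^k}(P)` lies in the local Kummer condition. [cite: SilvermanAEC2009, X.§4 diagram (**)] -/
theorem kummerLevelClass_mem (k : ℕ) (P : (W.baseChange F).toAffine.Point) :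
    kummerLevelClass W F p k P ∈ W.kummerLocalConditionAt ((p ^ k : ℕ) : ℤ) F :=
  W.localKummerMap_mem F _ P

omit [CharZero F] in
/-- `κ_{p^k}(0) = 0`. [cite: SilvermanAEC2009, VIII §2] -/
theorem kummerLevelClass_zero (k : ℕ) : kummerLevelClass W F p k 0 = 0 := by
  have h := kummerLevelClass_add W F p k 0 0
  rw [add_zero] at h
  exact left_eq_add.mp h

omit [CharZero F] in
/-- `κ_{p^k}(P − P′) = κ_{p^k}(P) − κ_{p^k}(P′)`. [cite: SilvermanAEC2009, VIII §2] -/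
theorem kummerLevelClass_sub (k : ℕ) (P P' : (W.baseChange F).toAffine.Point) :
    kummerLevelClass W F p k (P - P') = kummerLevelClass W F p k P - kummerLevelClass W F p k P' := by
  rw [eq_sub_iff_add_eq, ← kummerLevelClass_add, sub_add_cancel]

/-- **`κ_{p^k}(P) = κ_{p^k}(P′)` forces `φ(P) ≡ φ(P′) (mod p^k)`** for every additive `φ : E(F) → ℤ_p`: `P − P′ ∈ ker κ_{p^k} =
p^k E(F)` (the tree's `ker_localKummerMap`). [cite: SilvermanAEC2009, VIII §2] [cite: MilneADT2006, I §3 Cor. 3.4] -/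
theorem toZModPow_apply_eq_of_kummerLevelClass_eq (φ : (W.baseChange F).toAffine.Point →+ ℤ_[p]) (k : ℕ)
    {P P' : (W.baseChange F).toAffine.Point} (h : kummerLevelClass W F p k P = kummerLevelClass W F p k P') :
    PadicInt.toZModPow k (φ P) = PadicInt.toZModPow k (φ P') := by
  have h0 : P - P' ∈ (W.localKummerMap F (pow_ne_zero_int' p k)).ker := by
    rw [AddMonoidHom.mem_ker, map_sub]
    exact sub_eq_zero.mpr h
  rw [W.ker_localKummerMap F (pow_ne_zero_int' p k)] at h0
  obtain ⟨R₀, hR₀⟩ := h0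
  have hPP' : P - P' = ((p ^ k : ℕ) : ℤ) • R₀ := hR₀.symm
  rw [← sub_eq_zero, ← map_sub, ← map_sub, hPP', map_zsmul, map_zsmul, natCast_zsmul, nsmul_eq_mul,
    ZMod.natCast_self, zero_mul]

/-- **The functional `κ_{p^k}(P) ↦ φ(P) mod p^k` on the local Kummer condition** `𝓛 ≤ H¹(F, E[p^k]|_{Γ_F})` (well defined by
`toZModPow_apply_eq_of_kummerLevelClass_eq`, total by `exists_kummerLevelClass_eq_of_mem`). [cite: MilneADT2006, I §3 Cor. 3.4] -/
def kummerFunctional (φ : (W.baseChange F).toAffine.Point →+ ℤ_[p]) (k : ℕ) :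
    W.kummerLocalConditionAt ((p ^ k : ℕ) : ℤ) F →+ ZMod (p ^ k) where
  toFun c := PadicInt.toZModPow k (φ (exists_kummerLevelClass_eq_of_mem W F p k c.2).choose)
  map_zero' := by
    have h := (exists_kummerLevelClass_eq_of_mem W F p k (0 : W.kummerLocalConditionAt ((p ^ k : ℕ) : ℤ) F).2).choose_spec
    rw [toZModPow_apply_eq_of_kummerLevelClass_eq W F p φ k (P' := 0) (by rw [h, kummerLevelClass_zero]; rfl), map_zero,
      map_zero]
  map_add' c c' := by
    have h := (exists_kummerLevelClass_eq_of_mem W F p k (c + c').2).choose_spec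
    have hc := (exists_kummerLevelClass_eq_of_mem W F p k c.2).choose_spec
    have hc' := (exists_kummerLevelClass_eq_of_mem W F p k c'.2).choose_spec
    rw [← map_add, ← map_add]
    exact toZModPow_apply_eq_of_kummerLevelClass_eq W F p φ k (by
      rw [h, kummerLevelClass_add, hc, hc']; rfl)

/-- The value of `kummerFunctional` on `κ_{p^k}(P)` is `φ(P) mod p^k`. [cite: MilneADT2006, I §3 Cor. 3.4] -/
theorem kummerFunctional_kummerLevelClass (φ : (W.baseChange F).toAffine.Point →+ ℤ_[p]) (k : ℕ)
    (P : (W.baseChange F).toAffine.Point) :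
    kummerFunctional W F p φ k ⟨kummerLevelClass W F p k P, kummerLevelClass_mem W F p k P⟩ = PadicInt.toZModPow k (φ P) :=
  toZModPow_apply_eq_of_kummerLevelClass_eq W F p φ k
    (exists_kummerLevelClass_eq_of_mem W F p k (kummerLevelClass_mem W F p k P)).choose_spec

/-! ### Levelwise representability by local Tate duality -/

variable (e : (k : ℕ) → geomTorsion W ((p ^ k : ℕ) : ℤ) → geomTorsion W ((p ^ k : ℕ) : ℤ) → AlgebraicClosure K₀)
  (hμ : ∀ k S T, e k S T ^ (p ^ k) = 1)
  (hadd₁ : ∀ k S₁ S₂ T, e k (S₁ + S₂) T = e k S₁ T * e k S₂ T)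
  (hadd₂ : ∀ k S T₁ T₂, e k S (T₁ + T₂) = e k S T₁ * e k S T₂)
  (hgal : ∀ k (σ : absoluteGaloisGroup K₀) (S T : geomTorsion W ((p ^ k : ℕ) : ℤ)),
    σ • e k S T = e k (σ • S) (σ • T))
  (hnondeg : ∀ k (T : geomTorsion W ((p ^ k : ℕ) : ℤ)), (∀ S, e k S T = 1) → T = 0)
  (hcompat : ∀ k (S T : geomTorsion W ((p ^ (k + 1) : ℕ) : ℤ)),
    e k (torsionMulHom W (p ^ (k + 1)) (p ^ k) p (pow_succ p k).symm S)
      (torsionMulHom W (p ^ (k + 1)) (p ^ k) p (pow_succ p k).symm T) = e (k + 1) S T ^ p)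

variable [ValuativeRel F] [TopologicalSpace F] [IsNonarchimedeanLocalField F]

include hnondeg in
/-- ★ **Levelwise local Tate duality with the Kummer image**: for every additive `φ : E(F) → ℤ_p` and every `k` there is
`x_k ∈ H¹(F, E[p^k]|_{Γ_F})` with `⟨x_k, κ_{p^k}(P)⟩_{p^k, inv_{p^k}} = φ(P) mod p^k` for all `P ∈ E(F)` (extend the functional
`κ_{p^k}(P) ↦ φ(P) mod p^k` from the Kummer image to `H¹` by `AddMonoidHom.exists_comp_subtype_eq_of_nsmul_eq_zero`, then represent it
by the perfect level pairing for THE invariant map, `levelTatePairing_bijective_of_bijective` + `invLevel_bijective`).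
[cite: MilneADT2006, I Cor. 2.3 and I §3 Cor. 3.4] [cite: BlochKato1990, Prop. 3.8 (p. 354)] -/
theorem exists_levelTatePairing_kummerLevelClass_eq (φ : (W.baseChange F).toAffine.Point →+ ℤ_[p]) (k : ℕ) :
    ∃ x : continuousCohomology 1 (torsionRestricted W F (p ^ k)).toTopRep, ∀ P : (W.baseChange F).toAffine.Point,
      levelTatePairing W F (p ^ k) (e k) (hμ k) (hadd₁ k) (hadd₂ k) (hgal k) (Prop121vii.invLevel F (p ^ k)) x
          (kummerLevelClass W F p k P) = PadicInt.toZModPow k (φ P) := by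
  have hH : ∀ c : continuousCohomology 1 (torsionRestricted W F (p ^ k)).toTopRep, (p ^ k) • c = 0 :=
    nsmul_continuousCohomology_one_eq_zero _ _ fun T : geomTorsion W ((p ^ k : ℕ) : ℤ) => AddSubgroup.torsionBy.nsmul T
  haveI : Finite (continuousCohomology 1 (torsionRestricted W F (p ^ k)).toTopRep) :=
    finite_galoisCohomology_one_torsion_restrictField W (p ^ k) F
  obtain ⟨Ψ, hΨ⟩ := AddMonoidHom.exists_comp_subtype_eq_of_nsmul_eq_zero hH
    (W.kummerLocalConditionAt ((p ^ k : ℕ) : ℤ) F) (kummerFunctional W F p φ k)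
  obtain ⟨hl, -⟩ := levelTatePairing_bijective_of_bijective W F (p ^ k) (e k) (hμ k) (hadd₁ k) (hadd₂ k) (hgal k)
    (hnondeg k) (Prop121vii.invLevel F (p ^ k)) (invLevel_bijective F (p ^ k))
  obtain ⟨x, hx⟩ := hl.2 Ψ
  refine ⟨x, fun P => ?_⟩
  rw [hx, ← kummerFunctional_kummerLevelClass W F p φ k P]
  exact hΨ ⟨kummerLevelClass W F p k P, kummerLevelClass_mem W F p k P⟩


/-! ### Coherent choice along the tower (Kőnig) -/

/-- **Sequential Kőnig lemma**: an `ℕ`-tower of non-empty finite sets `f k : S (k+1) → S k` has a coherent sequence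
`s k ∈ S k`, `f k (s (k+1)) = s k` (Mathlib's `nonempty_sections_of_finite_inverse_system` for `Functor.ofOpSequence`).
[cite: NeukirchSchmidtWingberg2008, II §7 (2.7.5) (Mittag-Leffler for towers of finite sets)] -/
theorem exists_seq_apply_succ_eq {S : ℕ → Type} [∀ k, Finite (S k)] [∀ k, Nonempty (S k)]
    (f : ∀ k, S (k + 1) → S k) : ∃ s : ∀ k, S k, ∀ k, f k (s (k + 1)) = s k := by
  let G : ℕᵒᵖ ⥤ Type := Functor.ofOpSequence (X := S) (fun k => TypeCat.ofHom (f k))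
  haveI : ∀ j : ℕᵒᵖ, Finite (G.obj j) := fun j => by
    change Finite (S j.unop); infer_instance
  haveI : ∀ j : ℕᵒᵖ, Nonempty (G.obj j) := fun j => by
    change Nonempty (S j.unop); infer_instance
  obtain ⟨s, hs⟩ := nonempty_sections_of_finite_inverse_system G
  refine ⟨fun k => s (Opposite.op k), fun k => ?_⟩
  have h := hs (homOfLE (Nat.le_add_right k 1)).op
  have hmap : G.map (homOfLE (Nat.le_add_right k 1)).op = TypeCat.ofHom (f k) :=
    Functor.ofOpSequence_map_homOfLE_succ _ k
  rw [hmap] at h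
  exact h

include hnondeg hcompat in
/-- ★★ **[TD] coherently along the tower**: for every additive `φ : E(F) → ℤ_p` there is a family
`x_k ∈ H¹(F, E[p^k]|_{Γ_F})`, COMPATIBLE along `p : E[p^{k+1}] → E[p^k]` (`p_* x_{k+1} = x_k`), with
`⟨x_k, κ_{p^k}(P)⟩_{p^k, inv_{p^k}} = φ(P) mod p^k` for all `k` and all `P ∈ E(F)` — the levelwise representability
(`exists_levelTatePairing_kummerLevelClass_eq`) + the level change of floor (b) and the compatibility of the Kummer classes +
Kőnig's lemma on the non-empty finite sets of solutions. What is left of [TD]: lifting `(x_k)_k` to ONE class of `H¹(F, T_pW)`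
(`H¹(lim) = lim H¹`, NSW (2.7.5)). [cite: MilneADT2006, I Cor. 2.3 and I §3 Cor. 3.4] [cite: NeukirchSchmidtWingberg2008, (7.2.6) and II §7 (2.7.5)] -/
theorem exists_coherent_levelTatePairing_kummerLevelClass_eq (φ : (W.baseChange F).toAffine.Point →+ ℤ_[p]) :
    ∃ x : ∀ k, continuousCohomology 1 (torsionRestricted W F (p ^ k)).toTopRep,
      (∀ k, (cohomologyMap (torsionMulMor W F (p ^ (k + 1)) (p ^ k) p (pow_succ p k).symm) 1).hom (x (k + 1)) = x k) ∧
      ∀ k (P : (W.baseChange F).toAffine.Point),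
        levelTatePairing W F (p ^ k) (e k) (hμ k) (hadd₁ k) (hadd₂ k) (hgal k) (Prop121vii.invLevel F (p ^ k)) (x k)
          (kummerLevelClass W F p k P) = PadicInt.toZModPow k (φ P) := by
  -- the non-empty finite sets of level-`k` solutions
  let S : ℕ → Type := fun k => {x : continuousCohomology 1 (torsionRestricted W F (p ^ k)).toTopRep //
    ∀ P : (W.baseChange F).toAffine.Point,
      levelTatePairing W F (p ^ k) (e k) (hμ k) (hadd₁ k) (hadd₂ k) (hgal k) (Prop121vii.invLevel F (p ^ k)) x
        (kummerLevelClass W F p k P) = PadicInt.toZModPow k (φ P)}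
  haveI : ∀ k, Finite (S k) := fun k => by
    haveI : Finite (continuousCohomology 1 (torsionRestricted W F (p ^ k)).toTopRep) :=
      finite_galoisCohomology_one_torsion_restrictField W (p ^ k) F
    exact Subtype.finite
  haveI : ∀ k, Nonempty (S k) := fun k => by
    obtain ⟨x, hx⟩ := exists_levelTatePairing_kummerLevelClass_eq W F p e hμ hadd₁ hadd₂ hgal hnondeg φ k
    exact ⟨⟨x, hx⟩⟩
  -- the transition maps `p_*` preserve solutions
  let f : ∀ k, S (k + 1) → S k := fun k x =>
    ⟨(cohomologyMap (torsionMulMor W F (p ^ (k + 1)) (p ^ k) p (pow_succ p k).symm) 1).hom x.1, fun P => by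
      have h := levelTatePairing_invLevel_levelChange W F (p ^ (k + 1)) (p ^ k) p (pow_succ p k).symm
        (e (k + 1)) (hμ (k + 1)) (hadd₁ (k + 1)) (hadd₂ (k + 1)) (hgal (k + 1))
        (e k) (hμ k) (hadd₁ k) (hadd₂ k) (hgal k) (hcompat k) x.1 (kummerLevelClass W F p (k + 1) P)
      rw [cohomologyMap_torsionMulMor_kummerLevelClass] at h
      rw [h, x.2 P, ZMod.castHom_apply, PadicInt.cast_toZModPow k (k + 1) k.le_succ]⟩
  obtain ⟨s, hs⟩ := exists_seq_apply_succ_eq f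
  exact ⟨fun k => (s k).1, fun k => congrArg Subtype.val (hs k), fun k P => (s k).2 P⟩

end Literature.NumberTheory.EllipticCurves

end
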